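import Mathlib
import HarnessLib
import Summits.ValiantsHypothesis.ValiantsHypothesis.Theorems.LacunarySymmetroidMatrixDescartesProductPlusOneMomentLogConvex
import Summits.ValiantsHypothesis.ValiantsHypothesis.Theorems.LacunarySymmetroidMatrixDescartesProductPlusOneOneRiserDefs

/-!
# LINE (A) `product_plus_one` — one-riser interaction lemma, part 1: calculus of the puller moments and of `Ψ = S₁ + S₂/S₁`

Memo `pub/val-lit/lmr/NOTE-p7g15-18050-LINEA-incoherent-cell.md` §9 in kernel (crux item stmt-ValiantsHypothesis-18050, LINE (A)
floor structure).  A cloud of UNSWITCHED binomial pullers `(m_i, z_i)_{i ∈ s}` (`m_i > 0`, puller `i` vanishes at `Y = z_i`) has moments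
`S_k(Y) = momentS s m z k Y = Σ_i m_i (z_i − Y)^{−k}` and `Ψ = psiFun s m z = S₁ + S₂/S₁` (objects: `…ProductPlusOneOneRiserDefs`).

* §1 `hasDerivAt_inv_pow_sub`, `hasDerivAt_momentS`, `hasDerivAt_momentS'` — `S_{k+1}′ = (k+1)·S_{k+2}` below every pole; `momentS_pos`;
  `momentS_eq_sum_pow` (the moments are weighted power sums in `u_i = 1/(z_i − Y)`, so ✓ `moment_cauchySchwarz` applies);
* §2 `eq_at_most_twice_of_deriv_factor` — Rolle count: a function whose derivative is `g·D` with `g > 0` and `D` strictly increasing takes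
  each value at most twice;
* §3 `hasDerivAt_psiFun`, `hasDerivAt_psiDeriv` — `psiDeriv`, `psiDeriv2` ARE `Ψ′`, `Ψ″`; `psiFun_pos`, `psiDeriv_pos`;
  ★ `psi_logConvex : 0 < Ψ·Ψ″ − Ψ′²` (by ✓ `psi_certificate_of_moments`), and
  ★ `strictMonoOn_logDerivPsi` — `T(Y) = Y·Ψ′(Y)/Ψ(Y)` is strictly increasing on `(0, z_min)` (derivative `(Ψ′Ψ + Y(ΨΨ″ − Ψ′²))/Ψ² > 0`).

Part 2 (`…ProductPlusOneOneRiserSeparation`) turns this into the zero count.  Honest framing: calculus lemmas; they bound no zero count by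
themselves; NOT `OneChangeFloorK3` / `stub_classRowK3` / `stub_polyLaw` / `MatrixDescartes` / B; `VP ≠ VNP` NOT proved.  No definitions
(those are in `…OneRiserDefs`), no named facts; Mathlib only.
-/

set_option linter.dupNamespace false

namespace Summit.ValiantsHypothesis.ValiantsHypothesis.Theorems.LacunarySymmetroidMatrixDescartes

namespace ProductPlusOne

open Finset
open scoped BigOperators

/-! ### §1 The puller moments `S_k(Y) = Σ m_i/(z_i − Y)^k` and their derivatives -/

/-- `d/dY [m/(z − Y)^{k+1}] = m(k+1)/(z − Y)^{k+2}` for `Y ≠ z`. [folklore] -/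
theorem hasDerivAt_inv_pow_sub (m z : ℝ) (k : ℕ) {Y : ℝ} (hY : Y ≠ z) :
    HasDerivAt (fun t : ℝ => m / (z - t) ^ (k + 1)) (m * (k + 1) / (z - Y) ^ (k + 2)) Y := by
  have hzY : z - Y ≠ 0 := sub_ne_zero.2 (Ne.symm hY)
  have h0 : HasDerivAt (fun t : ℝ => z - t) (-1) Y := by simpa using (hasDerivAt_id Y).const_sub z
  have h1 : HasDerivAt (fun t : ℝ => (z - t) ^ (k + 1)) (((k + 1 : ℕ) : ℝ) * (z - Y) ^ (k + 1 - 1) * (-1)) Y :=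
    h0.pow (k + 1)
  have h2 : HasDerivAt (fun t : ℝ => m * ((z - t) ^ (k + 1))⁻¹)
      (m * (-(((k + 1 : ℕ) : ℝ) * (z - Y) ^ (k + 1 - 1) * (-1)) / ((z - Y) ^ (k + 1)) ^ 2)) Y :=
    (h1.inv (pow_ne_zero _ hzY)).const_mul m
  have h3 : HasDerivAt (fun t : ℝ => m / (z - t) ^ (k + 1))
      (m * (-(((k + 1 : ℕ) : ℝ) * (z - Y) ^ (k + 1 - 1) * (-1)) / ((z - Y) ^ (k + 1)) ^ 2)) Y :=
    h2.congr_of_eventuallyEq (Filter.Eventually.of_forall fun t => by simp [div_eq_mul_inv])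
  refine h3.congr_deriv ?_
  rw [Nat.add_sub_cancel]
  push_cast
  field_simp
  ring

/-- `S_{k+1}′ = (k+1)·S_{k+2}` below all the `z_i`. [folklore] -/
theorem hasDerivAt_momentS {ι : Type*} (s : Finset ι) (m z : ι → ℝ) (k : ℕ) {Y : ℝ} (hY : ∀ i ∈ s, Y < z i) :
    HasDerivAt (fun t : ℝ => ∑ i ∈ s, m i / (z i - t) ^ (k + 1))
      (((k : ℝ) + 1) * ∑ i ∈ s, m i / (z i - Y) ^ (k + 2)) Y := by
  have h := HasDerivAt.fun_sum (u := s) (fun i hi => hasDerivAt_inv_pow_sub (m i) (z i) k (ne_of_lt (hY i hi)))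
  rw [Finset.mul_sum]
  refine h.congr_deriv (Finset.sum_congr rfl fun i _ => by ring)

section Pullers

variable {ι : Type*} (s : Finset ι) (m z : ι → ℝ)

/-- `S_k > 0` below every pole (nonempty cloud, positive weights). -/
theorem momentS_pos (hs : s.Nonempty) (hm : ∀ i ∈ s, 0 < m i) (k : ℕ) {Y : ℝ} (hY : ∀ i ∈ s, Y < z i) :
    0 < momentS s m z k Y :=
  Finset.sum_pos (fun i hi => div_pos (hm i hi) (pow_pos (sub_pos.2 (hY i hi)) k)) hs

/-- `S_{k+1}′ = (k+1)·S_{k+2}` below every pole, in `momentS` currency. -/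
theorem hasDerivAt_momentS' (k : ℕ) {Y : ℝ} (hY : ∀ i ∈ s, Y < z i) :
    HasDerivAt (momentS s m z (k + 1)) (((k : ℝ) + 1) * momentS s m z (k + 2) Y) Y := by
  unfold momentS
  exact hasDerivAt_momentS s m z k hY

/-- the moments are power sums in `u_i = 1/(z_i − Y)`: `S_k = Σ m_i u_i^k`. -/
theorem momentS_eq_sum_pow (k : ℕ) (Y : ℝ) :
    momentS s m z k Y = ∑ i ∈ s, m i * ((z i - Y)⁻¹) ^ k := by
  unfold momentS
  refine Finset.sum_congr rfl fun i _ => ?_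
  rw [inv_pow, div_eq_mul_inv]

end Pullers

/-! ### §2 Rolle count: derivative `g·D`, `g > 0`, `D` strictly increasing ⇒ each value at most twice -/

/-- **Rolle count**: a function with a derivative of the form `g(x)·D(x)` on an interval, `g > 0` and `D` strictly increasing there, takes
each value at most twice (three equal values would give two zeros of `D`). [folklore] -/
theorem eq_at_most_twice_of_deriv_factor {f g D : ℝ → ℝ} {lo hi : ℝ}
    (hf : ∀ x ∈ Set.Icc lo hi, ∃ f' : ℝ, HasDerivAt f f' x ∧ f' = g x * D x)
    (hg : ∀ x ∈ Set.Icc lo hi, 0 < g x) (hD : StrictMonoOn D (Set.Icc lo hi))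
    {x₁ x₂ x₃ : ℝ} (h1 : lo ≤ x₁) (h12 : x₁ < x₂) (h23 : x₂ < x₃) (h3 : x₃ ≤ hi)
    (e12 : f x₁ = f x₂) (e23 : f x₂ = f x₃) : False := by
  have hcont : ∀ a b, lo ≤ a → b ≤ hi → ContinuousOn f (Set.Icc a b) := by
    intro a b ha hb x hx
    obtain ⟨f', hf', _⟩ := hf x ⟨ha.trans hx.1, hx.2.trans hb⟩
    exact hf'.continuousAt.continuousWithinAt
  -- Rolle on [x₁,x₂] and [x₂,x₃]
  obtain ⟨ξ₁, hξ₁, hξ₁'⟩ := exists_deriv_eq_zero h12 (hcont x₁ x₂ h1 (h23.le.trans h3)) e12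
  obtain ⟨ξ₂, hξ₂, hξ₂'⟩ := exists_deriv_eq_zero h23 (hcont x₂ x₃ (h1.trans h12.le) h3) e23
  have hI₁ : ξ₁ ∈ Set.Icc lo hi := ⟨h1.trans hξ₁.1.le, (hξ₁.2.trans h23).le.trans h3⟩
  have hI₂ : ξ₂ ∈ Set.Icc lo hi := ⟨(h1.trans h12.le).trans hξ₂.1.le, hξ₂.2.le.trans h3⟩
  obtain ⟨f₁, hf₁, ef₁⟩ := hf ξ₁ hI₁
  obtain ⟨f₂, hf₂, ef₂⟩ := hf ξ₂ hI₂
  rw [hf₁.deriv] at hξ₁'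
  rw [hf₂.deriv] at hξ₂'
  have hD1 : D ξ₁ = 0 := by
    have := hg ξ₁ hI₁
    rw [hξ₁'] at ef₁
    rcases mul_eq_zero.1 ef₁.symm with h | h
    · exact absurd h this.ne'
    · exact h
  have hD2 : D ξ₂ = 0 := by
    have := hg ξ₂ hI₂
    rw [hξ₂'] at ef₂
    rcases mul_eq_zero.1 ef₂.symm with h | h
    · exact absurd h this.ne'
    · exact h
  have hlt : ξ₁ < ξ₂ := hξ₁.2.trans hξ₂.1
  have := hD hI₁ hI₂ hlt
  rw [hD1, hD2] at this
  exact lt_irrefl 0 this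

/-! ### §3 `Ψ`, its two derivatives, log-convexity, and the strictly increasing `T = Y Ψ′/Ψ` -/

section Psi

variable {ι : Type*} {s : Finset ι} {m z : ι → ℝ}

/-- `psiDeriv` is the derivative of `Ψ = psiFun` below every pole. -/
theorem hasDerivAt_psiFun (hs : s.Nonempty) (hm : ∀ i ∈ s, 0 < m i) {Y : ℝ} (hY : ∀ i ∈ s, Y < z i) :
    HasDerivAt (psiFun s m z) (psiDeriv s m z Y) Y := by
  have h1 : HasDerivAt (momentS s m z 1) (momentS s m z 2 Y) Y := by
    simpa using hasDerivAt_momentS' s m z 0 hY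
  have h2 : HasDerivAt (momentS s m z 2) (2 * momentS s m z 3 Y) Y := by
    have := hasDerivAt_momentS' s m z 1 hY; norm_num at this; exact this
  have hS1 : momentS s m z 1 Y ≠ 0 := (momentS_pos s m z hs hm 1 hY).ne'
  have hq : HasDerivAt (fun t => momentS s m z 2 t / momentS s m z 1 t)
      ((2 * momentS s m z 3 Y * momentS s m z 1 Y - momentS s m z 2 Y * momentS s m z 2 Y) / momentS s m z 1 Y ^ 2) Y :=
    h2.div h1 hS1
  have h : HasDerivAt (fun t => momentS s m z 1 t + momentS s m z 2 t / momentS s m z 1 t)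
      (momentS s m z 2 Y + (2 * momentS s m z 3 Y * momentS s m z 1 Y - momentS s m z 2 Y * momentS s m z 2 Y) / momentS s m z 1 Y ^ 2) Y :=
    h1.add hq
  unfold psiFun psiDeriv
  refine h.congr_deriv ?_
  field_simp

/-- `psiDeriv2` is the derivative of `psiDeriv` (so the second derivative of `Ψ`) below every pole. -/
theorem hasDerivAt_psiDeriv (hs : s.Nonempty) (hm : ∀ i ∈ s, 0 < m i) {Y : ℝ} (hY : ∀ i ∈ s, Y < z i) :
    HasDerivAt (psiDeriv s m z) (psiDeriv2 s m z Y) Y := by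
  have h1 : HasDerivAt (momentS s m z 1) (momentS s m z 2 Y) Y := by
    simpa using hasDerivAt_momentS' s m z 0 hY
  have h2 : HasDerivAt (momentS s m z 2) (2 * momentS s m z 3 Y) Y := by
    have := hasDerivAt_momentS' s m z 1 hY; norm_num at this; exact this
  have h3 : HasDerivAt (momentS s m z 3) (3 * momentS s m z 4 Y) Y := by
    have := hasDerivAt_momentS' s m z 2 hY; norm_num at this; exact this
  have hS1 : momentS s m z 1 Y ≠ 0 := (momentS_pos s m z hs hm 1 hY).ne'
  -- numerator `2 S₁ S₃ − S₂·S₂` and denominator `S₁·S₁`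
  have hnum : HasDerivAt (fun t => 2 * (momentS s m z 1 t * momentS s m z 3 t) - momentS s m z 2 t * momentS s m z 2 t)
      (2 * (momentS s m z 2 Y * momentS s m z 3 Y + momentS s m z 1 Y * (3 * momentS s m z 4 Y))
        - (2 * momentS s m z 3 Y * momentS s m z 2 Y + momentS s m z 2 Y * (2 * momentS s m z 3 Y))) Y :=
    ((h1.mul h3).const_mul 2).sub (h2.mul h2)
  have hden : HasDerivAt (fun t => momentS s m z 1 t * momentS s m z 1 t)
      (momentS s m z 2 Y * momentS s m z 1 Y + momentS s m z 1 Y * momentS s m z 2 Y) Y := h1.mul h1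
  have hquot := hnum.div hden (mul_ne_zero hS1 hS1)
  have h : HasDerivAt (fun t => momentS s m z 2 t
      + (2 * (momentS s m z 1 t * momentS s m z 3 t) - momentS s m z 2 t * momentS s m z 2 t) / (momentS s m z 1 t * momentS s m z 1 t))
      _ Y := h2.add hquot
  have hfun : psiDeriv s m z = fun t => momentS s m z 2 t
      + (2 * (momentS s m z 1 t * momentS s m z 3 t) - momentS s m z 2 t * momentS s m z 2 t) / (momentS s m z 1 t * momentS s m z 1 t) := by
    funext t; unfold psiDeriv; ring
  rw [hfun]
  refine h.congr_deriv ?_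
  unfold psiDeriv2
  field_simp
  ring

/-- `Ψ > 0` below every pole. -/
theorem psiFun_pos (hs : s.Nonempty) (hm : ∀ i ∈ s, 0 < m i) {Y : ℝ} (hY : ∀ i ∈ s, Y < z i) : 0 < psiFun s m z Y := by
  unfold psiFun
  have := momentS_pos s m z hs hm 1 hY
  have := momentS_pos s m z hs hm 2 hY
  positivity

/-- `Ψ′ > 0` below every pole (`2S₁S₃ − S₂² ≥ S₁S₃ > 0` by Cauchy–Schwarz). -/
theorem psiDeriv_pos (hs : s.Nonempty) (hm : ∀ i ∈ s, 0 < m i) {Y : ℝ} (hY : ∀ i ∈ s, Y < z i) : 0 < psiDeriv s m z Y := by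
  unfold psiDeriv
  have h1 := momentS_pos s m z hs hm 1 hY
  have h2 := momentS_pos s m z hs hm 2 hY
  -- Cauchy–Schwarz `S₂² ≤ S₁ S₃` via the power-sum form
  have hm' : ∀ i ∈ s, 0 ≤ m i := fun i hi => (hm i hi).le
  have hu' : ∀ i ∈ s, 0 ≤ (z i - Y)⁻¹ := fun i hi => (inv_pos.2 (sub_pos.2 (hY i hi))).le
  have hcs := moment_cauchySchwarz s m (fun i => (z i - Y)⁻¹) hm' hu' 1
  rw [← momentS_eq_sum_pow, ← momentS_eq_sum_pow, ← momentS_eq_sum_pow] at hcs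
  have : 0 ≤ (2 * momentS s m z 1 Y * momentS s m z 3 Y - momentS s m z 2 Y ^ 2) / momentS s m z 1 Y ^ 2 :=
    div_nonneg (by nlinarith) (by positivity)
  linarith

/-- ★ the log-convexity numerator: `Ψ·Ψ″ − Ψ′² > 0`. [this file's theorem] -/
theorem psi_logConvex (hs : s.Nonempty) (hm : ∀ i ∈ s, 0 < m i) {Y : ℝ} (hY : ∀ i ∈ s, Y < z i) :
    0 < psiFun s m z Y * psiDeriv2 s m z Y - psiDeriv s m z Y ^ 2 := by
  have h1 := momentS_pos s m z hs hm 1 hY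
  have hu : ∀ i ∈ s, 0 < (z i - Y)⁻¹ := fun i hi => inv_pos.2 (sub_pos.2 (hY i hi))
  have hX := psi_certificate_of_moments s hs m (fun i => (z i - Y)⁻¹) hm hu
  simp only [← momentS_eq_sum_pow] at hX
  have e1 : (∑ i ∈ s, m i * (z i - Y)⁻¹) = momentS s m z 1 Y := by
    rw [momentS_eq_sum_pow]; simp
  rw [e1] at hX
  -- `S₁⁴ (ΨΨ″ − Ψ′²) = X`
  have hid : psiFun s m z Y * psiDeriv2 s m z Y - psiDeriv s m z Y ^ 2
      = ((momentS s m z 1 Y ^ 2 + momentS s m z 2 Y)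
          * (2 * momentS s m z 1 Y ^ 3 * momentS s m z 3 Y + 6 * momentS s m z 1 Y ^ 2 * momentS s m z 4 Y
            - 6 * momentS s m z 1 Y * momentS s m z 2 Y * momentS s m z 3 Y + 2 * momentS s m z 2 Y ^ 3)
        - (momentS s m z 1 Y ^ 2 * momentS s m z 2 Y + 2 * momentS s m z 1 Y * momentS s m z 3 Y - momentS s m z 2 Y ^ 2) ^ 2)
        / momentS s m z 1 Y ^ 4 := by
    unfold psiFun psiDeriv psiDeriv2
    field_simp
    ring
  rw [hid]
  exact div_pos hX (by positivity)

/-- ★ **`T = Y·Ψ′/Ψ` is strictly increasing on `(0, z_min)`**. [this file's theorem] -/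
theorem strictMonoOn_logDerivPsi (hs : s.Nonempty) (hm : ∀ i ∈ s, 0 < m i) {zmin : ℝ} (hzmin : ∀ i ∈ s, zmin ≤ z i) :
    StrictMonoOn (fun Y : ℝ => Y * psiDeriv s m z Y / psiFun s m z Y) (Set.Ioo 0 zmin) := by
  have hY : ∀ Y ∈ Set.Ioo (0 : ℝ) zmin, ∀ i ∈ s, Y < z i := fun Y hYm i hi => hYm.2.trans_le (hzmin i hi)
  have hder : ∀ Y ∈ Set.Ioo (0 : ℝ) zmin, HasDerivAt (fun Y : ℝ => Y * psiDeriv s m z Y / psiFun s m z Y)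
      (((psiDeriv s m z Y + Y * psiDeriv2 s m z Y) * psiFun s m z Y - Y * psiDeriv s m z Y * psiDeriv s m z Y)
        / psiFun s m z Y ^ 2) Y := by
    intro Y hYm
    have hP := hasDerivAt_psiFun hs hm (hY Y hYm)
    have hP' := hasDerivAt_psiDeriv hs hm (hY Y hYm)
    have hnum : HasDerivAt (fun t : ℝ => t * psiDeriv s m z t) (1 * psiDeriv s m z Y + Y * psiDeriv2 s m z Y) Y :=
      (hasDerivAt_id Y).mul hP'
    have h := hnum.div hP (psiFun_pos hs hm (hY Y hYm)).ne'
    refine h.congr_deriv ?_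
    ring
  refine strictMonoOn_of_deriv_pos (convex_Ioo 0 zmin) ?_ ?_
  · exact fun Y hYm => (hder Y hYm).continuousAt.continuousWithinAt
  · intro Y hYm
    rw [interior_Ioo] at hYm
    rw [(hder Y hYm).deriv]
    have hΨ := psiFun_pos hs hm (hY Y hYm)
    have hΨ' := psiDeriv_pos hs hm (hY Y hYm)
    have hlc := psi_logConvex hs hm (hY Y hYm)
    apply div_pos _ (by positivity)
    have : (psiDeriv s m z Y + Y * psiDeriv2 s m z Y) * psiFun s m z Y - Y * psiDeriv s m z Y * psiDeriv s m z Y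
        = psiDeriv s m z Y * psiFun s m z Y + Y * (psiFun s m z Y * psiDeriv2 s m z Y - psiDeriv s m z Y ^ 2) := by ring
    rw [this]
    have hY0 : 0 < Y := hYm.1
    positivity

end Psi

end ProductPlusOne

end Summit.ValiantsHypothesis.ValiantsHypothesis.Theorems.LacunarySymmetroidMatrixDescartes
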